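import Literature.Analysis.FunctionSpaces.TorusGevreyCompactness
import HarnessLib

/-!
# Gevrey interpolation on the lattice `ℤ^d`: small in `ℓ²` and bounded in a Gevrey class is small in every `H^m`

Analysis/FunctionSpaces support file (everything proved; no definitions, no named facts), companion of
`TorusGevreyCompactness.lean` and `TorusGevreySobolevBounds.lean`. For a coefficient family
`c : ℤ^d → V` (`V` any normed group; Fourier coefficients of fields on `T^d`) the **Gevrey bound**
`∑_{k∈S} e^{2σ|k|} ‖c k‖² ≤ G` (all finite `S ⊆ ℤ^d`, `σ > 0`, `|k| = (freqNormSq k)^{1/2}`; the Gevrey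
classes `D(e^{σA^{1/2}})` of Foias–Temam 1989) together with `ℓ²`-smallness `∑_{k∈S} ‖c k‖² ≤ δ` forces
smallness of every polynomially weighted sum: for all `m : ℕ` and `ε > 0` there is `δ = δ(σ, G, m, ε) > 0`
with `∑_{k∈S} (1 + |k|²)^m ‖c k‖² ≤ ε` for all finite `S`
(`Torus.exists_sobolev_le_of_gevreyBound_of_l2_le`). On the torus side this is the elementary
interpolation "`L²`-small and Gevrey-bounded `⇒` `H^m`-small" by which `L²`-convergence on a Gevrey ball
upgrades to convergence in every Sobolev norm.

## The proof (split of low and high frequencies, done termwise)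

With `K = (2m)! σ^{-2m} e^{σ}` one has `(1 + t²)^m e^{-σt} ≤ K` for `t ≥ 0`
(`Torus.one_add_sq_pow_mul_exp_neg_le`), whence for every threshold `R` and every `t ≥ 0`

  `(1 + t²)^m ≤ (1 + R²)^m + K e^{-σR} e^{2σt}`

(`Torus.one_add_sq_pow_le_add_mul_exp`: for `t ≤ R` the first summand dominates, for `t > R`
`(1 + t²)^m = (1 + t²)^m e^{-σt} · e^{-σt} · e^{2σt} ≤ K e^{-σR} e^{2σt}`). Summing against `‖c k‖²`
over a finite `S` gives `∑_S (1 + |k|²)^m ‖c k‖² ≤ (1 + R²)^m δ + K e^{-σR} G`; with `L = 2KG/ε`,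
`R = L/σ` and `e^{L} ≥ 1 + L` the second term is `≤ KG/(1 + L) ≤ ε/2`, and `δ = ε / (2 (1 + R²)^m)` makes
the first term `ε/2`.

## Mathlib / tree search

Tree (reused): `Torus.one_add_sq_pow_mul_exp_neg_le` (`TorusGevreyCompactness`), `freqNormSq_nonneg`
(`TorusSobolevNorm`), `one_add_freqNormSq_pow_nonneg` (`TorusFourierSynthesis`); Mathlib
`Real.add_one_le_exp`, `Real.exp_le_exp`, `inv_anti₀`. Searched `Gevrey`, `gevreyBound`, `Interpolation`
under `FunctionSpaces/` and `FluidPDE/`: `TorusGevreySobolevBounds` bounds the Sobolev sums by `G` times a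
lattice constant (no smallness), `TorusSmallnessInterpolation` is the physical-side `L²`-small/`H³`-bounded
`⇒ C¹`-small statement on `T³` (Kato 1975); no lattice `ℓ²`/Gevrey interpolation.

## References

* C. Foias, R. Temam, *Gevrey class regularity for the solutions of the Navier–Stokes equations*,
  J. Funct. Anal. 87 (1989), 359–369 (the Gevrey classes `D(e^{σA^{1/2}})`). [FoiasTemam1989]
* P. Constantin, C. Foias, *Navier–Stokes Equations*, Univ. Chicago Press 1988, Ch. 4 (spectral Sobolev
  norms on the torus, interpolation).
-/

noncomputable section

open _root_.MeasureTheory Set Filter Function UnitAddTorus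
open scoped Topology ENNReal BigOperators

namespace Literature.Analysis.FunctionSpaces

namespace Torus

variable {d : Type*} [Fintype d]

/-! ### The termwise low/high-frequency split of the polynomial weight -/

omit [Fintype d] in
/-- **Polynomial weights split into a low-frequency constant and a Gevrey tail**: for `σ > 0`, `m : ℕ`,
any threshold `R` and `t ≥ 0`,
`(1 + t²)^m ≤ (1 + R²)^m + (2m)! σ^{-2m} e^{σ} · e^{-σR} · e^{2σt}`
(for `t ≤ R` by monotonicity of `(1 + t²)^m`; for `t > R` from `(1 + t²)^m e^{-σt} ≤ (2m)! σ^{-2m} e^{σ}`,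
`Torus.one_add_sq_pow_mul_exp_neg_le`, and `e^{-σt} ≤ e^{-σR}`). [folklore] -/
theorem one_add_sq_pow_le_add_mul_exp {σ : ℝ} (hσ : 0 < σ) (m : ℕ) (R : ℝ) {t : ℝ} (ht : 0 ≤ t) :
    (1 + t ^ 2) ^ m ≤ (1 + R ^ 2) ^ m +
      (2 * m).factorial / σ ^ (2 * m) * Real.exp σ * Real.exp (-(σ * R)) * Real.exp (2 * σ * t) := by
  set K : ℝ := (2 * m).factorial / σ ^ (2 * m) * Real.exp σ with hK
  have hK0 : 0 ≤ K := by positivity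
  rcases le_or_gt t R with htR | hRt
  · -- low frequencies: `(1 + t²)^m ≤ (1 + R²)^m`
    have h1 : (1 + t ^ 2) ^ m ≤ (1 + R ^ 2) ^ m :=
      pow_le_pow_left₀ (by positivity) (by linarith [pow_le_pow_left₀ ht htR 2]) m
    exact le_add_of_le_of_nonneg h1 (by positivity)
  · -- high frequencies: `(1 + t²)^m = (1 + t²)^m e^{-σt} · (e^{-σt} e^{2σt}) ≤ K e^{-σR} e^{2σt}`
    have h2 : (1 + t ^ 2) ^ m * Real.exp (-(σ * t)) ≤ K := one_add_sq_pow_mul_exp_neg_le hσ m ht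
    have h3 : Real.exp (-(σ * t)) ≤ Real.exp (-(σ * R)) := Real.exp_le_exp.2 (by nlinarith)
    have hsplit : (1 + t ^ 2) ^ m =
        (1 + t ^ 2) ^ m * Real.exp (-(σ * t)) * (Real.exp (-(σ * t)) * Real.exp (2 * σ * t)) := by
      rw [mul_assoc, ← Real.exp_add, ← Real.exp_add]
      have h0 : -(σ * t) + (-(σ * t) + 2 * σ * t) = 0 := by ring
      rw [h0, Real.exp_zero, mul_one]
    have h4 : (1 + t ^ 2) ^ m ≤ K * Real.exp (-(σ * R)) * Real.exp (2 * σ * t) := by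
      calc (1 + t ^ 2) ^ m
          = (1 + t ^ 2) ^ m * Real.exp (-(σ * t)) * (Real.exp (-(σ * t)) * Real.exp (2 * σ * t)) :=
            hsplit
        _ ≤ K * (Real.exp (-(σ * R)) * Real.exp (2 * σ * t)) :=
            mul_le_mul h2 (mul_le_mul_of_nonneg_right h3 (Real.exp_pos _).le) (by positivity) hK0
        _ = K * Real.exp (-(σ * R)) * Real.exp (2 * σ * t) := by ring
    exact le_add_of_nonneg_of_le (by positivity) h4

/-- The termwise split at a lattice frequency `k ∈ ℤ^d` (`t = |k| = (freqNormSq k)^{1/2}`, `t² = |k|²`):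
`(1 + |k|²)^m ≤ (1 + R²)^m + (2m)! σ^{-2m} e^{σ} e^{-σR} e^{2σ|k|}`. [folklore] -/
theorem one_add_freqNormSq_pow_le_add_mul_exp {σ : ℝ} (hσ : 0 < σ) (m : ℕ) (R : ℝ) (k : d → ℤ) :
    (1 + freqNormSq k) ^ m ≤ (1 + R ^ 2) ^ m +
      (2 * m).factorial / σ ^ (2 * m) * Real.exp σ * Real.exp (-(σ * R)) *
        Real.exp (2 * σ * Real.sqrt (freqNormSq k)) := by
  have h := one_add_sq_pow_le_add_mul_exp hσ m R (Real.sqrt_nonneg (freqNormSq k))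
  rwa [Real.sq_sqrt (freqNormSq_nonneg k)] at h

/-! ### Gevrey interpolation -/

/-- **Gevrey interpolation on the lattice** (Foias–Temam 1989 Gevrey classes; the elementary interpolation
"small in `ℓ²` and bounded in `D(e^{σA^{1/2}})` `⇒` small in every `H^m`"): for `σ > 0`, `G ≥ 0`, `m : ℕ`
and `ε > 0` there is `δ > 0` such that every family `c : ℤ^d → V` with
`∑_{k∈S} e^{2σ|k|} ‖c k‖² ≤ G` and `∑_{k∈S} ‖c k‖² ≤ δ` for all finite `S ⊆ ℤ^d` satisfies
`∑_{k∈S} (1 + |k|²)^m ‖c k‖² ≤ ε` for all finite `S` (termwise low/high-frequency split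
`Torus.one_add_freqNormSq_pow_le_add_mul_exp` at the threshold `R = 2KG/(εσ)`, `K = (2m)! σ^{-2m} e^{σ}`,
and `δ = ε / (2(1 + R²)^m)`). [folklore] -/
theorem exists_sobolev_le_of_gevreyBound_of_l2_le {V : Type*} [NormedAddCommGroup V] (σ G : ℝ)
    (hσ : 0 < σ) (hG : 0 ≤ G) (m : ℕ) (ε : ℝ) (hε : 0 < ε) :
    ∃ δ : ℝ, 0 < δ ∧ ∀ c : (d → ℤ) → V,
      (∀ S' : Finset (d → ℤ), ∑ k ∈ S', Real.exp (2 * σ * Real.sqrt (freqNormSq k)) * ‖c k‖ ^ 2 ≤ G) →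
      (∀ S' : Finset (d → ℤ), ∑ k ∈ S', ‖c k‖ ^ 2 ≤ δ) →
      ∀ S' : Finset (d → ℤ), ∑ k ∈ S', (1 + freqNormSq k) ^ m * ‖c k‖ ^ 2 ≤ ε := by
  -- the constants: `K` (Gevrey beats polynomial), `L = 2KG/ε`, the threshold `R = L/σ`, `A = (1 + R²)^m`
  set K : ℝ := (2 * m).factorial / σ ^ (2 * m) * Real.exp σ with hK
  have hK0 : 0 < K := by positivity
  set L : ℝ := 2 * K * G / ε with hL
  have hL1 : 0 < L + 1 := by positivity
  set R : ℝ := L / σ with hR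
  have hσR : σ * R = L := by rw [hR]; field_simp
  set A : ℝ := (1 + R ^ 2) ^ m with hA
  have hA0 : 0 < A := by positivity
  -- the high-frequency factor: `K e^{-σR} G = KG e^{-L} ≤ KG / (1 + L) ≤ ε/2`
  have hhigh : K * Real.exp (-(σ * R)) * G ≤ ε / 2 := by
    rw [hσR]
    have h1 : Real.exp (-L) ≤ (L + 1)⁻¹ := by
      rw [Real.exp_neg]
      exact inv_anti₀ hL1 (Real.add_one_le_exp L)
    have h2 : ε / 2 * (L + 1) = K * G + ε / 2 := by
      rw [hL]
      field_simp
    calc K * Real.exp (-L) * G = K * G * Real.exp (-L) := by ring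
      _ ≤ K * G * (L + 1)⁻¹ := mul_le_mul_of_nonneg_left h1 (mul_nonneg hK0.le hG)
      _ ≤ ε / 2 := by
          rw [← div_eq_mul_inv, div_le_iff₀ hL1, h2]
          linarith
  refine ⟨ε / (2 * A), by positivity, fun c hGc hδc S' => ?_⟩
  -- termwise split, summed over `S'`
  have hterm : ∀ k : d → ℤ, (1 + freqNormSq k) ^ m * ‖c k‖ ^ 2 ≤
      A * ‖c k‖ ^ 2 +
        K * Real.exp (-(σ * R)) * (Real.exp (2 * σ * Real.sqrt (freqNormSq k)) * ‖c k‖ ^ 2) := fun k =>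
    calc (1 + freqNormSq k) ^ m * ‖c k‖ ^ 2
        ≤ (A + K * Real.exp (-(σ * R)) * Real.exp (2 * σ * Real.sqrt (freqNormSq k))) * ‖c k‖ ^ 2 :=
          mul_le_mul_of_nonneg_right (one_add_freqNormSq_pow_le_add_mul_exp hσ m R k) (sq_nonneg _)
      _ = A * ‖c k‖ ^ 2 +
            K * Real.exp (-(σ * R)) * (Real.exp (2 * σ * Real.sqrt (freqNormSq k)) * ‖c k‖ ^ 2) := by
          ring
  have hAδ : A * (ε / (2 * A)) = ε / 2 := by
    field_simp
  calc ∑ k ∈ S', (1 + freqNormSq k) ^ m * ‖c k‖ ^ 2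
      ≤ ∑ k ∈ S', (A * ‖c k‖ ^ 2 +
          K * Real.exp (-(σ * R)) * (Real.exp (2 * σ * Real.sqrt (freqNormSq k)) * ‖c k‖ ^ 2)) :=
        Finset.sum_le_sum fun k _ => hterm k
    _ = A * ∑ k ∈ S', ‖c k‖ ^ 2 +
          K * Real.exp (-(σ * R)) * ∑ k ∈ S', Real.exp (2 * σ * Real.sqrt (freqNormSq k)) * ‖c k‖ ^ 2 := by
        rw [Finset.sum_add_distrib, Finset.mul_sum, Finset.mul_sum]
    _ ≤ A * (ε / (2 * A)) + K * Real.exp (-(σ * R)) * G :=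
        add_le_add (mul_le_mul_of_nonneg_left (hδc S') hA0.le)
          (mul_le_mul_of_nonneg_left (hGc S') (by positivity))
    _ ≤ ε := by
        rw [hAδ]
        linarith

end Torus

end Literature.Analysis.FunctionSpaces

end
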